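import Summits.QuantumFields.BalabanUV.Beta.FP.TorusSymGaugeCovariance
import Summits.QuantumFields.BalabanUV.Beta.FP.PeriodisedCompositeIndexWard

/-!
# `BalabanUV.Beta.FP.PeriodisedSymCompositeIndexWard` — road «FP» for binder row D1, ROUTE T, the dictionary's (J-a) «THE DOOR AT THE LITERAL OF RECORD
# (chart (III′))», item (α-1b) of an2's `JA-TABLE.v1.md`: **THE `q1` LETTER AT THE SYM TABLES** — the sym twin of `FP/PeriodisedCompositeIndexWard` (p320102):
# with `A₁ = −c_j•E_λ`, `Ā₁ = c_j•R′_λ̄` (the SAME diagonal transports), the conjugated first-order COMPOSITE averaging word of the shifted spreads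
# `𝕄_{j+1}·𝕄_j` along `h` IS the composite insertion of the symmetrised border tables along `h + Dλ`

WHAT.  §1 **`torus_symQ10_mul_tgrad_fun`** (`(Q₁₀·Dλ) = stepScale_j·#B·(Dλ̄)`, `λ̄` = `λ` at the CENTRED roots — over (α-1c)'s torus MASTER
`TorusSymGaugeCovariance.perF_bhKStepSh_Dsh_mul_tgrad_sum`); §2 **`torus_symQ21_pureGauge_fun`** (the `Q₂`-word one level up, over (α-1)'s
`PeriodisedSymBorderIndexWard.torus_sym_pureGauge_fun_of_presentation`; `theta_mul` BY NAME); §3 **`torus_sym_conj_first_composite_word`** and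
**`torus_q1_sym_letter`** (`Xbar * 𝔔₀ + 𝔔₁ + 𝔔₀ * X = 𝔔₁^{(h + Dλ)}` in the letter shape of `NestedStepLawTorusTransported`) — the `q1` SUPPLIER of (β)
`…RowsGradedLevelZeroSym` in the shape my g20 `…RowsGraded` consumes p320102.  Statements = the rooted ones with `vhSAt (toSite r∕r′) ↦ symVhSAt ρ_c`,
`bhKStepAt d (toSite r∕r′) Lc ↦ bhKStepSh d Lc (Dsh Lc)`, both roots `↦ ρ_c = ctr (d+1) Lc`, `hr hr′` dropped.  [folklore] finite sums BY NAME; no `def`,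
no `def … : Prop`, nothing cited, 0 sorry.  Nothing of the dictionary ∕ Bałaban's asserted.

HONEST DEPENDENCY (page 1, mandatory): continuum YM on T⁴ ⇐ BetaPertH ∧ nine spine estimates (0/9 proved); BetaPertH ⇐ (D1) ∧ (D4) ∧ CAP+tail;
G-an2-4 gates asym, D1 and NE2/3/4.  HONEST FRAMING (cell contract, verbatim): «discharging `BetaPertH` makes Bałaban's UV stability UNCONDITIONAL —
a real constructive-QFT result; it is NOT the continuum limit and NOT the Clay problem.»  ABSOLUTE RULE (cell charter, verbatim): «No internally-minted
statement may enter as a cited fact. Every hypothesis is either kernel-proved in this package or a verbatim quotation of a PUBLISHED theorem with page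
reference. The manuscript(s) under audit are NOT citable for their own disputed steps — they are the thing under adjudication; programme-internal
(2001/route/tribunal) claims are never citable.»  0 estimates; 0∕4 row-D1 binders; NOT (T-ID), NOT (J-a) complete, NOT SDF, NOT D1, NOT BetaPertH, NOT
continuum, NOT Clay.  D1 formalisation swarm LEAF PROVER 02 (b2b-balaban-beta-d1-formalise-leaf-02 gen 21), 2026-08-22.  No existing file touched.
-/

noncomputable section

open scoped BigOperators

namespace Summit.QuantumFields.BalabanUV.Beta.FP.PeriodisedSymCompositeIndexWard

open Finset Matrix
open Literature.Probability.LatticeModels (Torus.proj)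
open Literature.MathematicalPhysics.QuantumFieldTheory.Balaban1983to89
open Literature.MathematicalPhysics.QuantumFieldTheory.Balaban1983to89.Beta
open B5Prop11Plancherel (fine)
open B6Lemma24Torus (pbox mem_pbox)
open AffineAveraging (Site box toSite unitVec)
open AveragingContoursRooted (ctr ctrOff ctrOff_mem_box)
open OneStepResolventKernel (Fib)
open Summit.QuantumFields.BalabanUV.Beta.BorderedHessian (stepScale stepScale_ne_zero)
open Summit.QuantumFields.BalabanUV.Beta.DshAn1 (Dsh)
open Summit.QuantumFields.BalabanUV.Beta.SymAveragingHessianCounts (symVhSAt)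
open Summit.QuantumFields.BalabanUV.Beta.SymShiftedSpread (bhKStepSh)
open Summit.QuantumFields.BalabanUV.Beta.FP.KernelPeriodisationFib (Idx perF perF_apply)
open Summit.QuantumFields.BalabanUV.Beta.FP.KernelPeriodisationFibLoc (dper)
open Summit.QuantumFields.BalabanUV.Beta.FP.TorusGaugeCovariance (tdelta tdelta_congr tgrad tgrad_inl sum_mul_tgrad_eq_sum_inl)
open Summit.QuantumFields.BalabanUV.Beta.FP.TorusGaugeCovarianceCoarse (coarsePt coarsePt_coe proj_coarsePt)
open Summit.QuantumFields.BalabanUV.Beta.FP.TorusGaugeCovariancePairing (wrapPt wrapPt_coe wrapPt_of_mem sum_tdelta_mul)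
open Summit.QuantumFields.BalabanUV.Beta.FP.TorusSymGaugeCovariance (perF_bhKStepSh_Dsh_mul_tgrad_sum)
open Summit.QuantumFields.BalabanUV.Beta.FP.PeriodisedSymBorderIndexWard (torus_symQ11_pureGauge_fun torus_sym_pureGauge_fun_of_presentation)
open Summit.QuantumFields.BalabanUV.Beta.FP.PeriodisedCompositeIndexWard (theta_mul)

variable {d : ℕ} (M' : Fin (d + 1) → ℕ) [∀ μ, NeZero (M' μ)] {Lc : ℕ} [NeZero Lc]

/-! ## §1 The linear average of a torus pure gauge is the COARSE pure gauge of the gauge function read at the block roots -/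

section Average

/-- [folklore] **`(Q₁₀·Dλ)(p̄, m) = stepScale_j · #B · (Dλ̄)(p̄, m)` FOR THE SHIFTED SPREAD's ROWS** (sym twin of `PeriodisedCompositeIndexWard.torus_Q10_mul_tgrad_fun` over (α-1c)'s MASTER `TorusSymGaugeCovariance.perF_bhKStepSh_Dsh_mul_tgrad_sum`) with the INDUCED coarse gauge function `λ̄ t̄ := Σ_s tdelta F (Lc•t̄ + ρ_c) s · λ s` (= `λ` at the box
representative of the root of block `t̄`): the multiplier row `(coarsePt p̄, inr m)` of the torus call's `Q₁₀` (`hQ₁₀` VERBATIM) against the torus gradient of `λ` is the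
coarse torus gradient of `λ̄` (re-read through `tdelta`). -/
theorem torus_symQ10_mul_tgrad_fun (j : ℕ) (lam : ↥(pbox (fine Lc M')) → ℝ)
    {Q₁₀ : Matrix (↥(pbox M') × Fin (d + 1)) (↥(pbox (fine Lc M')) × Fin (d + 1)) ℝ}
    (hQ₁₀ : Q₁₀ = (perF (fine Lc M') (bhKStepSh d Lc (Dsh Lc) j)).submatrix
        (fun a : ↥(pbox M') × Fin (d + 1) => ((coarsePt M' Lc a.1, Sum.inr a.2) : Idx (fine Lc M') (Fib d)))
        (fun b : ↥(pbox (fine Lc M')) × Fin (d + 1) => ((b.1, Sum.inl b.2) : Idx (fine Lc M') (Fib d))))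
    (a : ↥(pbox M') × Fin (d + 1)) :
    ∑ b : ↥(pbox (fine Lc M')) × Fin (d + 1), Q₁₀ a b * (∑ s : ↥(pbox (fine Lc M')), tgrad (fine Lc M') (b.1, Sum.inl b.2) s * lam s)
      = stepScale d Lc j * ((box (d + 1) Lc).card : ℝ)
          * ∑ t : ↥(pbox M'), tgrad M' (a.1, Sum.inl a.2) t
              * (∑ s : ↥(pbox (fine Lc M')), tdelta (fine Lc M') ((Lc : ℤ) • (t : Site (d + 1)) + ctr (d + 1) Lc) s * lam s) := by
  subst hQ₁₀
  -- left: swap the two finite sums, read the field-slot sum as the packed sum, and use the MASTER identity paired with `λ`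
  have hL : ∑ b : ↥(pbox (fine Lc M')) × Fin (d + 1),
        (perF (fine Lc M') (bhKStepSh d Lc (Dsh Lc) j)).submatrix
            (fun a : ↥(pbox M') × Fin (d + 1) => ((coarsePt M' Lc a.1, Sum.inr a.2) : Idx (fine Lc M') (Fib d)))
            (fun b : ↥(pbox (fine Lc M')) × Fin (d + 1) => ((b.1, Sum.inl b.2) : Idx (fine Lc M') (Fib d))) a b
          * (∑ s : ↥(pbox (fine Lc M')), tgrad (fine Lc M') (b.1, Sum.inl b.2) s * lam s)
      = ∑ s : ↥(pbox (fine Lc M')), (∑ q : Idx (fine Lc M') (Fib d),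
          perF (fine Lc M') (bhKStepSh d Lc (Dsh Lc) j) (coarsePt M' Lc a.1, Sum.inr a.2) q * tgrad (fine Lc M') q s) * lam s := by
    have e1 : ∀ s : ↥(pbox (fine Lc M')), (∑ q : Idx (fine Lc M') (Fib d),
          perF (fine Lc M') (bhKStepSh d Lc (Dsh Lc) j) (coarsePt M' Lc a.1, Sum.inr a.2) q * tgrad (fine Lc M') q s)
        = ∑ b : ↥(pbox (fine Lc M')) × Fin (d + 1),
            perF (fine Lc M') (bhKStepSh d Lc (Dsh Lc) j) (coarsePt M' Lc a.1, Sum.inr a.2) (b.1, Sum.inl b.2) * tgrad (fine Lc M') (b.1, Sum.inl b.2) s :=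
      fun s => by rw [sum_mul_tgrad_eq_sum_inl, Fintype.sum_prod_type]
    simp only [e1, Matrix.submatrix_apply, Finset.mul_sum, Finset.sum_mul, ← mul_assoc]
    exact Finset.sum_comm
  rw [hL, perF_bhKStepSh_Dsh_mul_tgrad_sum (fine Lc M') j (coarsePt M' Lc a.1) a.2 lam, if_pos (proj_coarsePt M' Lc a.1)]
  -- right: the coarse gradient of `λ̄` is `λ̄` at the far endpoint minus `λ̄` at the base; re-read the wrapped endpoint mod `F`
  have hR : ∑ t : ↥(pbox M'), tgrad M' (a.1, Sum.inl a.2) t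
        * (∑ s : ↥(pbox (fine Lc M')), tdelta (fine Lc M') ((Lc : ℤ) • (t : Site (d + 1)) + ctr (d + 1) Lc) s * lam s)
      = lam (wrapPt (fine Lc M') ((coarsePt M' Lc a.1 : Site (d + 1)) + ctr (d + 1) Lc + (Lc : ℤ) • unitVec a.2))
        - lam (wrapPt (fine Lc M') ((coarsePt M' Lc a.1 : Site (d + 1)) + ctr (d + 1) Lc)) := by
    simp only [tgrad_inl, sub_mul, Finset.sum_sub_distrib, sum_tdelta_mul]
    rw [wrapPt_of_mem]
    congr 1
    · congr 1
      apply Subtype.ext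
      rw [wrapPt_coe, wrapPt_coe]
      apply B6Lemma24Torus.wrap_congr
      intro i
      obtain ⟨k, hk⟩ := B6Lemma24Torus.isPeriod_sub_wrap (M := M') ((a.1 : Site (d + 1)) + unitVec a.2) i
      refine ⟨-k, ?_⟩
      simp only [Pi.sub_apply, Pi.add_apply] at hk
      simp only [Pi.add_apply, Pi.smul_apply, smul_eq_mul, coarsePt_coe, fine]
      push_cast
      linear_combination (-(Lc : ℤ)) * hk
  rw [hR, mul_assoc]

end Average

/-! ## §2 The chain-rule coarse insertion table along a torus pure gauge is a commutator ONE LEVEL UP (the `Q₂`-word) -/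

section CoarseWord

/-- [folklore] **THE `Q₂`-WORD AT THE SYM TABLES** (twin of `torus_Q21_pureGauge_fun`; `theta_mul` BY NAME from the rooted file): the chain-rule coarse insertion table (transport weight `θ_j·Q₁₀(a′, ·)`, as in `PeriodisedCoarseWardContact` ∕ `…Rows`) inserted along the
torus pure gauge `Dλ` is the commutator of the level-`(j+1)` averaging rows with the diagonal generators of the INDUCED coarse gauge function `λ̄` (at the fine level:
`R_λ = diagonal (λ̄ p̄)`; one level up: `R′_λ̄ = diagonal (Σ_t̄ tdelta M′ (pμ′ α + ρ′) t̄ · λ̄ t̄)`):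
`Σ_{a′} (θ_j · (Q₁₀·Dλ)(a′)) • Q₂₁^{a′} = c • (R′_λ̄ * Q₂₀ − Q₂₀ * R_λ)`, `c = (Lc^{d+1}·stepScale_j)⁻¹` — §1 + (α-1)'s `PeriodisedSymBorderIndexWard.torus_sym_pureGauge_fun_of_presentation`
on the coarse box (`Q₁₀ := perF F 𝕄_j∘…`, `Q₂₀ := perF M′ 𝕄_{j+1}∘…`, both combs at `ρ_c`; `Lc ∣ M′ᵢ`). -/
theorem torus_symQ21_pureGauge_fun (hM' : ∀ i, Lc ∣ M' i) (j : ℕ)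
    (lam : ↥(pbox (fine Lc M')) → ℝ)
    {κ : Type*} [Fintype κ] [DecidableEq κ] (pμ' : κ → ↥(pbox M')) (mμ' : κ → Fin (d + 1))
    {Q₁₀ : Matrix (↥(pbox M') × Fin (d + 1)) (↥(pbox (fine Lc M')) × Fin (d + 1)) ℝ}
    (hQ₁₀ : Q₁₀ = (perF (fine Lc M') (bhKStepSh d Lc (Dsh Lc) j)).submatrix
        (fun a : ↥(pbox M') × Fin (d + 1) => ((coarsePt M' Lc a.1, Sum.inr a.2) : Idx (fine Lc M') (Fib d)))
        (fun b : ↥(pbox (fine Lc M')) × Fin (d + 1) => ((b.1, Sum.inl b.2) : Idx (fine Lc M') (Fib d))))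
    {Q₂₀ : Matrix κ (↥(pbox M') × Fin (d + 1)) ℝ}
    (hQ₂₀ : Q₂₀ = (perF M' (bhKStepSh d Lc (Dsh Lc) (j + 1))).submatrix (fun a : κ => ((pμ' a, Sum.inr (mμ' a)) : Idx M' (Fib d)))
        (fun b : ↥(pbox M') × Fin (d + 1) => ((b.1, Sum.inl b.2) : Idx M' (Fib d)))) :
    (∑ a' : ↥(pbox M') × Fin (d + 1),
        (stepScale d Lc (j + 1) / (stepScale d Lc j ^ 2 * ((box (d + 1) Lc).card : ℝ))
          * ∑ b : ↥(pbox (fine Lc M')) × Fin (d + 1), Q₁₀ a' b * (∑ s : ↥(pbox (fine Lc M')), tgrad (fine Lc M') (b.1, Sum.inl b.2) s * lam s)) •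
        (perF M' (dper M' (symVhSAt (ctr (d + 1) Lc) d Lc rfl a'.2 (a'.1 : Site (d + 1))))).submatrix (fun a : κ => ((pμ' a, Sum.inr (mμ' a)) : Idx M' (Fib d)))
          (fun b : ↥(pbox M') × Fin (d + 1) => ((b.1, Sum.inl b.2) : Idx M' (Fib d))))
      = (((Lc : ℝ) ^ (d + 1) * stepScale d Lc j)⁻¹) •
          (Matrix.diagonal (fun α : κ => ∑ t : ↥(pbox M'), tdelta M' ((pμ' α : Site (d + 1)) + ctr (d + 1) Lc) t
              * (∑ s : ↥(pbox (fine Lc M')), tdelta (fine Lc M') ((Lc : ℤ) • (t : Site (d + 1)) + ctr (d + 1) Lc) s * lam s)) * Q₂₀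
            - Q₂₀ * Matrix.diagonal (fun a : ↥(pbox M') × Fin (d + 1) =>
              ∑ s : ↥(pbox (fine Lc M')), tdelta (fine Lc M') ((Lc : ℤ) • (a.1 : Site (d + 1)) + ctr (d + 1) Lc) s * lam s)) := by
  -- §1: the averaged gauge is the coarse gradient of `λ̄`, up to `stepScale_j·#B`
  simp only [torus_symQ10_mul_tgrad_fun M' j lam hQ₁₀, ← mul_assoc]
  simp only [mul_assoc _ (stepScale d Lc j) _, ← smul_smul, ← Finset.smul_sum]
  -- the level-`(j+1)` index-slot word on the coarse box, at the Delta's coarse-coarse presentation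
  have hM'' : ∀ i, M' i = Lc * (M' i / Lc) := fun i => (Nat.mul_div_cancel' (hM' i)).symm
  rw [torus_sym_pureGauge_fun_of_presentation (M := M') (M'' := fun i => M' i / Lc) hM'' (j + 1)
    (fun t : ↥(pbox M') => ∑ s : ↥(pbox (fine Lc M')), tdelta (fine Lc M') ((Lc : ℤ) • (t : Site (d + 1)) + ctr (d + 1) Lc) s * lam s)
    (fun a : κ => ((pμ' a : ↥(pbox M')) : Site (d + 1))) (fun a => (pμ' a).2) mμ' (Q₀ := Q₂₀) (by rw [hQ₂₀])]
  simp only [smul_smul]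
  congr 1
  rw [← theta_mul (d := d) (Lc := Lc) j]
  ring

end CoarseWord

/-! ## §3 The first-order conjugated COMPOSITE averaging word (`q1` of the OWNER g18's `NestedStepLawTransported`) at diagonal torus-gauge transports -/

section CompositeWord

/-- [folklore] **(T-β-1) AT ORDER 1 FOR THE COMPOSITE AVERAGING `𝔔 = Q₂·Q₁` AT THE SYM TABLES, IN THE OWNER's WORD SHAPE** (twin of `torus_conj_first_composite_word`) (`q1 : Ā₁𝔔₀A₀ + Ā₀𝔔₁A₀ + Ā₀𝔔₀A₁ = 𝔔♯₁` of `NestedStepLawTransported`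
with `A₀ = Ā₀ = 1`): for ANY direction `h` on the fine torus bonds and ANY torus gauge function `λ`, with leaf-02's order-1 objects along `h` — `Q₁^{(h)} := Σ_b h b • Q₁₁^{b}`
(rooted table, p314580's presentation) and the chain-rule coarse insertion `Q₂^{(h)} := Σ_b h b • Σ_{a′} (θ_j·Q₁₀ a′ b) • Q₂₁^{a′}` (`…Rows` ∕ `PeriodisedCoarseWardContact`) — and the
DIAGONAL transport jets `A₁ := −c • E_λ` (fine fields, `λ` at the base of the bond) and `Ā₁ := c • R′_λ̄` (coarse-coarse multipliers, the induced `λ̄` at the root of their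
coarse block; `c = (Lc^{d+1}·stepScale_j)⁻¹`):
`Ā₁ * (Q₂₀ * Q₁₀) * 1 + 1 * (Q₂^{(h)} * Q₁₀ + Q₂₀ * Q₁^{(h)}) * 1 + 1 * (Q₂₀ * Q₁₀) * A₁ = Q₂^{(h + Dλ)} * Q₁₀ + Q₂₀ * Q₁^{(h + Dλ)}`
— the intermediate rotation `R_λ` of the level-`j` multipliers CANCELS between the two words (`hQ₁₀ hQ₂₀` VERBATIM from the Delta; `Lc ∣ M′ᵢ`, `r r′ ∈ box`). -/
theorem torus_sym_conj_first_composite_word (hM' : ∀ i, Lc ∣ M' i) (j : ℕ)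
    (h : ↥(pbox (fine Lc M')) × Fin (d + 1) → ℝ) (lam : ↥(pbox (fine Lc M')) → ℝ)
    {κ : Type*} [Fintype κ] [DecidableEq κ] (pμ' : κ → ↥(pbox M')) (mμ' : κ → Fin (d + 1))
    {Q₁₀ : Matrix (↥(pbox M') × Fin (d + 1)) (↥(pbox (fine Lc M')) × Fin (d + 1)) ℝ}
    (hQ₁₀ : Q₁₀ = (perF (fine Lc M') (bhKStepSh d Lc (Dsh Lc) j)).submatrix
        (fun a : ↥(pbox M') × Fin (d + 1) => ((coarsePt M' Lc a.1, Sum.inr a.2) : Idx (fine Lc M') (Fib d)))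
        (fun b : ↥(pbox (fine Lc M')) × Fin (d + 1) => ((b.1, Sum.inl b.2) : Idx (fine Lc M') (Fib d))))
    {Q₂₀ : Matrix κ (↥(pbox M') × Fin (d + 1)) ℝ}
    (hQ₂₀ : Q₂₀ = (perF M' (bhKStepSh d Lc (Dsh Lc) (j + 1))).submatrix (fun a : κ => ((pμ' a, Sum.inr (mμ' a)) : Idx M' (Fib d)))
        (fun b : ↥(pbox M') × Fin (d + 1) => ((b.1, Sum.inl b.2) : Idx M' (Fib d))))
    -- the two insertion-table families along a weight `w`, by defining equations
    (Q₁₁ : (↥(pbox (fine Lc M')) × Fin (d + 1) → ℝ) → Matrix (↥(pbox M') × Fin (d + 1)) (↥(pbox (fine Lc M')) × Fin (d + 1)) ℝ)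
    (hQ₁₁ : ∀ w, Q₁₁ w = ∑ b : ↥(pbox (fine Lc M')) × Fin (d + 1), w b •
        (perF (fine Lc M') (dper (fine Lc M') (symVhSAt (ctr (d + 1) Lc) d Lc rfl b.2 (b.1 : Site (d + 1))))).submatrix
          (fun a : ↥(pbox M') × Fin (d + 1) => ((coarsePt M' Lc a.1, Sum.inr a.2) : Idx (fine Lc M') (Fib d)))
          (fun b : ↥(pbox (fine Lc M')) × Fin (d + 1) => ((b.1, Sum.inl b.2) : Idx (fine Lc M') (Fib d))))
    (Q₂₁ : (↥(pbox (fine Lc M')) × Fin (d + 1) → ℝ) → Matrix κ (↥(pbox M') × Fin (d + 1)) ℝ)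
    (hQ₂₁ : ∀ w, Q₂₁ w = ∑ b : ↥(pbox (fine Lc M')) × Fin (d + 1), w b •
        ∑ a' : ↥(pbox M') × Fin (d + 1), (stepScale d Lc (j + 1) / (stepScale d Lc j ^ 2 * ((box (d + 1) Lc).card : ℝ)) * Q₁₀ a' b) •
          (perF M' (dper M' (symVhSAt (ctr (d + 1) Lc) d Lc rfl a'.2 (a'.1 : Site (d + 1))))).submatrix (fun a : κ => ((pμ' a, Sum.inr (mμ' a)) : Idx M' (Fib d)))
            (fun b : ↥(pbox M') × Fin (d + 1) => ((b.1, Sum.inl b.2) : Idx M' (Fib d)))) :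
    ((((Lc : ℝ) ^ (d + 1) * stepScale d Lc j)⁻¹) •
          Matrix.diagonal (fun α : κ => ∑ t : ↥(pbox M'), tdelta M' ((pμ' α : Site (d + 1)) + ctr (d + 1) Lc) t
              * (∑ s : ↥(pbox (fine Lc M')), tdelta (fine Lc M') ((Lc : ℤ) • (t : Site (d + 1)) + ctr (d + 1) Lc) s * lam s)))
          * (Q₂₀ * Q₁₀) * (1 : Matrix (↥(pbox (fine Lc M')) × Fin (d + 1)) (↥(pbox (fine Lc M')) × Fin (d + 1)) ℝ)
        + (1 : Matrix κ κ ℝ) * (Q₂₁ h * Q₁₀ + Q₂₀ * Q₁₁ h) * (1 : Matrix (↥(pbox (fine Lc M')) × Fin (d + 1)) (↥(pbox (fine Lc M')) × Fin (d + 1)) ℝ)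
        + (1 : Matrix κ κ ℝ) * (Q₂₀ * Q₁₀) * (-((((Lc : ℝ) ^ (d + 1) * stepScale d Lc j)⁻¹) •
            Matrix.diagonal (fun b : ↥(pbox (fine Lc M')) × Fin (d + 1) => lam b.1)))
      = Q₂₁ (fun b => h b + ∑ s : ↥(pbox (fine Lc M')), tgrad (fine Lc M') (b.1, Sum.inl b.2) s * lam s) * Q₁₀
        + Q₂₀ * Q₁₁ (fun b => h b + ∑ s : ↥(pbox (fine Lc M')), tgrad (fine Lc M') (b.1, Sum.inl b.2) s * lam s) := by
  -- the two shifted tables: `Q₂^{(h+Dλ)} = Q₂^{(h)} + c•(R′Q₂₀ − Q₂₀R_λ)`, `Q₁^{(h+Dλ)} = Q₁^{(h)} + c•(R_λQ₁₀ − Q₁₀E_λ)`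
  have h2 : Q₂₁ (fun b => h b + ∑ s : ↥(pbox (fine Lc M')), tgrad (fine Lc M') (b.1, Sum.inl b.2) s * lam s)
      = Q₂₁ h + (((Lc : ℝ) ^ (d + 1) * stepScale d Lc j)⁻¹) •
          (Matrix.diagonal (fun α : κ => ∑ t : ↥(pbox M'), tdelta M' ((pμ' α : Site (d + 1)) + ctr (d + 1) Lc) t
              * (∑ s : ↥(pbox (fine Lc M')), tdelta (fine Lc M') ((Lc : ℤ) • (t : Site (d + 1)) + ctr (d + 1) Lc) s * lam s)) * Q₂₀
            - Q₂₀ * Matrix.diagonal (fun a : ↥(pbox M') × Fin (d + 1) =>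
              ∑ s : ↥(pbox (fine Lc M')), tdelta (fine Lc M') ((Lc : ℤ) • (a.1 : Site (d + 1)) + ctr (d + 1) Lc) s * lam s)) := by
    rw [hQ₂₁, hQ₂₁, ← torus_symQ21_pureGauge_fun M' hM' j lam pμ' mμ' hQ₁₀ hQ₂₀]
    simp only [add_smul, Finset.sum_add_distrib]
    congr 1
    -- swap the two finite sums and collect the weight `θ·Σ_b Q₁₀ a′ b (Dλ)_b`
    simp only [Finset.smul_sum, smul_smul]
    rw [Finset.sum_comm]
    refine Finset.sum_congr rfl fun a' _ => ?_
    rw [← Finset.sum_smul, Finset.mul_sum]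
    congr 1
    exact Finset.sum_congr rfl fun b _ => by ring
  have h1 : Q₁₁ (fun b => h b + ∑ s : ↥(pbox (fine Lc M')), tgrad (fine Lc M') (b.1, Sum.inl b.2) s * lam s)
      = Q₁₁ h + (((Lc : ℝ) ^ (d + 1) * stepScale d Lc j)⁻¹) •
          (Matrix.diagonal (fun a : ↥(pbox M') × Fin (d + 1) =>
              ∑ s : ↥(pbox (fine Lc M')), tdelta (fine Lc M') ((Lc : ℤ) • (a.1 : Site (d + 1)) + ctr (d + 1) Lc) s * lam s) * Q₁₀
            - Q₁₀ * Matrix.diagonal (fun b : ↥(pbox (fine Lc M')) × Fin (d + 1) => lam b.1)) := by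
    rw [hQ₁₁, hQ₁₁, ← torus_symQ11_pureGauge_fun M' j lam hQ₁₀]
    simp only [add_smul, Finset.sum_add_distrib]
  rw [h2, h1, Matrix.mul_one, Matrix.mul_one, Matrix.one_mul, Matrix.one_mul, Matrix.mul_neg, Matrix.mul_smul, Matrix.smul_mul,
    Matrix.add_mul, Matrix.mul_add, Matrix.smul_mul, Matrix.mul_smul, Matrix.sub_mul, Matrix.mul_sub, smul_sub, smul_sub,
    Matrix.mul_assoc, Matrix.mul_assoc, ← Matrix.mul_assoc Q₂₀ (Matrix.diagonal _) Q₁₀]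
  abel

/-- [folklore] **`q1` AT THE SYM TABLES, IN THE LETTER SHAPE OF THE OWNER g18's `NestedStepLawTorusTransported`** (twin of `torus_q1_letter` — the `q1` SUPPLIER of (β) `…RowsGradedLevelZeroSym`) (`q1 : Xbar * 𝔔₀ + 𝔔₁ + 𝔔₀ * X = 𝔔'₁`, unit jets erased, the composite jets NAMED by
the Delta's `h𝔔₀ : Q₂₀ * Q₁₀ = 𝔔₀`, `h𝔔₁ : Q₂₁ * Q₁₀ + Q₂₀ * Q₁₁ = 𝔔₁` along the direction `h`): with `X := −(c • E_λ)`, `Xbar := c • R′_λ̄`,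
`Xbar * 𝔔₀ + 𝔔₁ + 𝔔₀ * X = 𝔔₁^{(h + Dλ)}` (`:= Q₂^{(h+Dλ)} * Q₁₀ + Q₂₀ * Q₁^{(h+Dλ)}`). -/
theorem torus_q1_sym_letter (hM' : ∀ i, Lc ∣ M' i) (j : ℕ)
    (h : ↥(pbox (fine Lc M')) × Fin (d + 1) → ℝ) (lam : ↥(pbox (fine Lc M')) → ℝ)
    {κ : Type*} [Fintype κ] [DecidableEq κ] (pμ' : κ → ↥(pbox M')) (mμ' : κ → Fin (d + 1))
    {Q₁₀ : Matrix (↥(pbox M') × Fin (d + 1)) (↥(pbox (fine Lc M')) × Fin (d + 1)) ℝ}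
    (hQ₁₀ : Q₁₀ = (perF (fine Lc M') (bhKStepSh d Lc (Dsh Lc) j)).submatrix
        (fun a : ↥(pbox M') × Fin (d + 1) => ((coarsePt M' Lc a.1, Sum.inr a.2) : Idx (fine Lc M') (Fib d)))
        (fun b : ↥(pbox (fine Lc M')) × Fin (d + 1) => ((b.1, Sum.inl b.2) : Idx (fine Lc M') (Fib d))))
    {Q₂₀ : Matrix κ (↥(pbox M') × Fin (d + 1)) ℝ}
    (hQ₂₀ : Q₂₀ = (perF M' (bhKStepSh d Lc (Dsh Lc) (j + 1))).submatrix (fun a : κ => ((pμ' a, Sum.inr (mμ' a)) : Idx M' (Fib d)))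
        (fun b : ↥(pbox M') × Fin (d + 1) => ((b.1, Sum.inl b.2) : Idx M' (Fib d))))
    (Q₁₁ : (↥(pbox (fine Lc M')) × Fin (d + 1) → ℝ) → Matrix (↥(pbox M') × Fin (d + 1)) (↥(pbox (fine Lc M')) × Fin (d + 1)) ℝ)
    (hQ₁₁ : ∀ w, Q₁₁ w = ∑ b : ↥(pbox (fine Lc M')) × Fin (d + 1), w b •
        (perF (fine Lc M') (dper (fine Lc M') (symVhSAt (ctr (d + 1) Lc) d Lc rfl b.2 (b.1 : Site (d + 1))))).submatrix
          (fun a : ↥(pbox M') × Fin (d + 1) => ((coarsePt M' Lc a.1, Sum.inr a.2) : Idx (fine Lc M') (Fib d)))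
          (fun b : ↥(pbox (fine Lc M')) × Fin (d + 1) => ((b.1, Sum.inl b.2) : Idx (fine Lc M') (Fib d))))
    (Q₂₁ : (↥(pbox (fine Lc M')) × Fin (d + 1) → ℝ) → Matrix κ (↥(pbox M') × Fin (d + 1)) ℝ)
    (hQ₂₁ : ∀ w, Q₂₁ w = ∑ b : ↥(pbox (fine Lc M')) × Fin (d + 1), w b •
        ∑ a' : ↥(pbox M') × Fin (d + 1), (stepScale d Lc (j + 1) / (stepScale d Lc j ^ 2 * ((box (d + 1) Lc).card : ℝ)) * Q₁₀ a' b) •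
          (perF M' (dper M' (symVhSAt (ctr (d + 1) Lc) d Lc rfl a'.2 (a'.1 : Site (d + 1))))).submatrix (fun a : κ => ((pμ' a, Sum.inr (mμ' a)) : Idx M' (Fib d)))
            (fun b : ↥(pbox M') × Fin (d + 1) => ((b.1, Sum.inl b.2) : Idx M' (Fib d))))
    {𝔔₀ 𝔔₁ : Matrix κ (↥(pbox (fine Lc M')) × Fin (d + 1)) ℝ} (h𝔔₀ : Q₂₀ * Q₁₀ = 𝔔₀) (h𝔔₁ : Q₂₁ h * Q₁₀ + Q₂₀ * Q₁₁ h = 𝔔₁) :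
    ((((Lc : ℝ) ^ (d + 1) * stepScale d Lc j)⁻¹) •
          Matrix.diagonal (fun α : κ => ∑ t : ↥(pbox M'), tdelta M' ((pμ' α : Site (d + 1)) + ctr (d + 1) Lc) t
              * (∑ s : ↥(pbox (fine Lc M')), tdelta (fine Lc M') ((Lc : ℤ) • (t : Site (d + 1)) + ctr (d + 1) Lc) s * lam s))) * 𝔔₀
        + 𝔔₁
        + 𝔔₀ * (-((((Lc : ℝ) ^ (d + 1) * stepScale d Lc j)⁻¹) • Matrix.diagonal (fun b : ↥(pbox (fine Lc M')) × Fin (d + 1) => lam b.1)))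
      = Q₂₁ (fun b => h b + ∑ s : ↥(pbox (fine Lc M')), tgrad (fine Lc M') (b.1, Sum.inl b.2) s * lam s) * Q₁₀
        + Q₂₀ * Q₁₁ (fun b => h b + ∑ s : ↥(pbox (fine Lc M')), tgrad (fine Lc M') (b.1, Sum.inl b.2) s * lam s) := by
  subst h𝔔₀ h𝔔₁
  have hw := torus_sym_conj_first_composite_word M' hM' j h lam pμ' mμ' hQ₁₀ hQ₂₀ Q₁₁ hQ₁₁ Q₂₁ hQ₂₁
  simpa only [Matrix.mul_one, Matrix.one_mul] using hw

end CompositeWord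

end Summit.QuantumFields.BalabanUV.Beta.FP.PeriodisedSymCompositeIndexWard

end
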